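import Summits.ResolutionOfSingularities.ResolutionOfSingularities.Theorems.WeightedInvariantLocalWeightedDropNCTameBinomialWon
import Summits.ResolutionOfSingularities.ResolutionOfSingularities.Theorems.WeightedInvariantLocalWeightedDropNCTameBinomialRungClosed

/-!
# TOT rung R7b, CLOSED: tame relative binomials in four variables are won in the weighted game — binder-free

Crux item stmt-ResolutionOfSingularities-8899 `WeightedInvariant.LocalWeightedDrop` (route `ResolutionOfSingularities/WeightedInvariant`), line
`nc-game-transport`.  [OURS · L1 W4.3 · seat res-D-pv-006; def-free; NOT a statement of any manuscript.]

The consumption form `won_four_of_tameRelBinom` (`…NCTameBinomialWon`, res-L1-w43-strat-1's R7b sketch, binder `hR7` = `TOTRungTameBinomial 2`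
unfolded) instantiated with the tree theorem `NCTransport.totRungTameBinomial 2` (`…NCTameBinomialRungClosed`, res-D-pv-036): for `p ∤ d` and
non-zero `E, M, h ∈ k⟦x₀,x₁,x₂⟧` over an algebraically closed field of characteristic `p`, every divisor of a power of the relative binomial
`E·(M·x₃^d + h)` lies in `CobordantGame.Won k 4` as soon as the mover wins `E·M·h` within finitely many rounds (unconditional), resp. for all
such `E, M, h` modulo ⟨F-32bR⟩ (`CossartJannsenSaito2020EmbeddedSequenceB`).
-/

set_option linter.dupNamespace false -- mandated namespace of this single-conjunct summit

namespace Summit.ResolutionOfSingularities.ResolutionOfSingularities.Theorems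

namespace NCTransport

open MvPowerSeries Literature.AlgebraicGeometry.Resolution TameFourTupleDrop

variable {k : Type} [Field k]

/-- **R7b, BINDER-FREE**: for `p ∤ d` and non-zero `E, M, h ∈ k⟦x₀,x₁,x₂⟧` (`k` algebraically closed of characteristic `p`) whose product the
mover wins within finitely many rounds of the count game, every divisor `f` of a power of `E·(M·x₃^d + h)` is in `CobordantGame.Won k 4`. -/
theorem won_four_of_tameRelBinom_closed (p : ℕ) (hp : p.Prime) [CharP k p] [IsAlgClosed k] {d : ℕ} (hpd : ¬ p ∣ d)
    {E Mx h : MvPowerSeries (Fin 3) k} (hE : E ≠ 0) (hMx : Mx ≠ 0) (hh : h ≠ 0)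
    (hwin : ∃ n, WinsIn (m := 2) GermIsNC n (E * Mx * h)) (N : ℕ) (f : MvPowerSeries (Fin 4) k)
    (hf : f ∣ (rename Fin.castSucc E * (rename Fin.castSucc Mx * X 3 ^ d + rename Fin.castSucc h)) ^ (N + 1)) :
    CobordantGame.Won k 4 f :=
  won_four_of_tameRelBinom (totRungTameBinomial 2) p hp hpd hE hMx hh hwin N f hf

/-- **R7b MODULO ⟨F-32bR⟩, BINDER-FREE IN R7**: with the Cossart–Jannsen–Saito fact every divisor of a power of a tame relative binomial
`E·(M·x₃^d + h)` (`p ∤ d`; `E, M, h ≠ 0` in `k⟦x₀,x₁,x₂⟧`) is in `CobordantGame.Won k 4`. -/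
theorem won_four_of_tameRelBinom_of_CJSB_closed (hCJS : CossartJannsenSaito2020EmbeddedSequenceB.{0}) (p : ℕ) (hp : p.Prime)
    [CharP k p] [IsAlgClosed k] {d : ℕ} (hpd : ¬ p ∣ d) {E Mx h : MvPowerSeries (Fin 3) k} (hE : E ≠ 0) (hMx : Mx ≠ 0) (hh : h ≠ 0)
    (N : ℕ) (f : MvPowerSeries (Fin 4) k)
    (hf : f ∣ (rename Fin.castSucc E * (rename Fin.castSucc Mx * X 3 ^ d + rename Fin.castSucc h)) ^ (N + 1)) :
    CobordantGame.Won k 4 f :=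
  won_four_of_tameRelBinom_of_CJSB hCJS (totRungTameBinomial 2) p hp hpd hE hMx hh N f hf

end NCTransport

end Summit.ResolutionOfSingularities.ResolutionOfSingularities.Theorems
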